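import Summits.Ventures.HSemireg.SignedPureWeilSlicePairs

/-!
# Venture HSemireg — the SLICE-ANGLE obstruction for signed pure-Weil designs: the Weil moments of the six slice-pair designs of a
# pure design with Weil moment β are β·(1 − i)·unit ∕ 4 (adjacent pairs) and β·unit ∕ 2 (opposite pairs), so class-specific support
# minima at level n bound s(n+1) from below — THEOREM A: «all pure designs with ≤ B letters have real-or-imaginary Weil moment» ⇒
# s(n+1) ≥ 2(B+1); THEOREM B: s(n+1) ≥ 2·min(max(s_diag(n), s_axis(n)), s_other(n)) (every n)

HONEST FRAMING. Part of the Lean index of the computation cell `pub-hsemireg` (Sunday typer seat p9, § g = 8; family B row **B20-3**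
of `target-g8/CENSUS.md`: signed pure-Weil unit-graph designs are «class witnesses — cycles with ℤ-coefficients — not census objects»).
FINITE GAUSSIAN-INTEGER ARITHMETIC ONLY, in the vocabulary of `SignedPureWeilLadder.lean` ∕ `SignedPureWeilSlicePairs.lean` (`Letter`,
`Eps`, `vmoment`, `plus`, `minus`, `supp`, `sl`, `slOpp`, `sliceSupp`, `uTab`, `pTab`, `four_mul_pair`, `four_mul_opp`). No abelian
variety, cycle, sheaf or semiregularity map is constructed; t-20's dictionary (LEMMA W) is text of record, not a binder; nothing here
says that HC ∕ HC_CM ∕ HC_AV holds; no object is certified; no Literature fact is declared; no verdict ∕ door word ∕ count of the cell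
moves. The level-4 input AXIS31 of §4 is a MACHINE statement of the seat's record file `HOME/p9/S5-ANGLE-p9g9.md` (exact rational
linear algebra ×2 across codes over the ×2 exact-support census ES(4, ≤ 31) of `HOME/p9/S5-LOWER-p9g8.md`); here it is an explicit
HYPOTHESIS, never an axiom: the kernel statements of §4 are conditional.

THE ARGUMENT (all n; `S5-ANGLE-p9g9.md` §1). For a pure design `m` on (ℤ∕4)ⁿ⁺¹ with Weil moment β = m̂(+,…,+), the adjacent
slice-pair design `sl m a` has `4·W = (1 − i)i^{−a}·β` (`four_mul_pair`) and the opposite slice-difference design `slOpp m a` has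
`4·W = 2i^{−a}·β` (`four_mul_opp`). Call a Gaussian integer AXIS if its real or its imaginary part vanishes and DIAGONAL if its real
and imaginary parts agree up to sign (§1; only 0 is both). Multiplication by (1 − i)·unit exchanges the two classes, multiplication by
2·unit and by 4 preserves them (§1). Hence (§2): `W(sl m a)` is axis iff β is diagonal, diagonal iff β is axis; `W(slOpp m a)` has the
class of β. THEOREM A (§3, `two_mul_succ_le_card_supp_of_axis`): if every pure design on (ℤ∕4)ⁿ with at most B letters has axis Weil
moment, then a pure W-alive design on (ℤ∕4)ⁿ⁺¹ has at least 2(B+1) letters — an adjacent pair with ≤ B letters makes β diagonal, an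
opposite pair with ≤ B letters makes β axis, both make β = 0; otherwise the four adjacent pair designs have ≥ 4(B+1) letters in total,
at most 2·#supp m (`card_supp_sl_le`, `sum_card_slices`), or the two opposite ones have ≥ 2(B+1) letters in total, at most #supp m
(`card_supp_slOpp_le`). THEOREM B (§3, `two_mul_min_le_card_supp_of_classes`): with lower bounds B₁ ∕ B₂ ∕ B₃ for the supports of the
pure designs on (ℤ∕4)ⁿ whose Weil moment is nonzero diagonal ∕ nonzero axis ∕ neither, every pure W-alive design on (ℤ∕4)ⁿ⁺¹ has at
least 2·min(max(B₁, B₂), B₃) letters (β axis: adjacent pairs diagonal, opposite pairs axis; β diagonal: the roles exchanged; β neither: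
all pairs neither). With B₁ = B₂ = B₃ = s(n) this is LEMMA S (`card_support_step` of `SignedPureWeilMinimalDesigns.lean`).

§4 INSTANCES (conditional, hypotheses explicit): `s5_ge_64_of_axis31` — AXIS31 («every pure design on (ℤ∕4)⁴ with ≤ 31 letters has
axis Weil moment», machine) ⇒ every pure W-alive design on (ℤ∕4)⁵ has ≥ 64 letters (of record before this file: s(5) ≥ 63 machine by
level-5 kill tables, 32 kernel); `s5_ge_of_diag4` — s_diag(4) ≥ D ∧ s_axis(4) ≥ 28 ∧ s_other(4) ≥ D′ ⇒ s(5) ≥ 2·min(max(D, 28), D′)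
(machine inputs of record: D ∈ [32, 39], D′ ≥ 34; `S5-ANGLE-p9g9.md` §3).

WHAT IS NOT HERE. AXIS31 itself (machine); the value of s_diag(4) (open in [32, 39]); the exact value of s(5) (open in [64, 80] of record).
-/

namespace Summit.Ventures.HSemireg.SignedWeilDesignN

open Finset

variable {n : ℕ}

/-! ## §1 Axis and diagonal Gaussian integers -/

/-- A Gaussian integer is AXIS if it is real or purely imaginary. [definition of this file] -/
def IsAxis (z : GaussianInt) : Prop := z.re = 0 ∨ z.im = 0

/-- A Gaussian integer is DIAGONAL if its real and imaginary parts agree up to sign. [definition of this file] -/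
def IsDiag (z : GaussianInt) : Prop := z.re = z.im ∨ z.re = -z.im

/-- Only `0` is both axis and diagonal. -/
theorem eq_zero_of_isAxis_of_isDiag (z : GaussianInt) (ha : IsAxis z) (hd : IsDiag z) : z = 0 := by
  unfold IsAxis at ha
  unfold IsDiag at hd
  have hre : z.re = 0 := by omega
  have him : z.im = 0 := by omega
  cases z
  simp only at hre him
  subst hre
  subst him
  rfl

/-- Multiplication by `uTab a = (1 − i)·i^{−a}` turns diagonal into axis and conversely: `uTab a · z` is axis iff `z` is diagonal. -/
theorem isAxis_uTab_mul_iff (a : Fin 4) (z : GaussianInt) : IsAxis (uTab a * z) ↔ IsDiag z := by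
  unfold IsAxis IsDiag
  fin_cases a <;> simp [uTab] <;> omega

/-- `uTab a · z` is diagonal iff `z` is axis. -/
theorem isDiag_uTab_mul_iff (a : Fin 4) (z : GaussianInt) : IsDiag (uTab a * z) ↔ IsAxis z := by
  unfold IsAxis IsDiag
  fin_cases a <;> simp [uTab] <;> omega

/-- Multiplication by `pTab a = 2·i^{−a}` preserves the axis class. -/
theorem isAxis_pTab_mul_iff (a : Fin 4) (z : GaussianInt) : IsAxis (pTab a * z) ↔ IsAxis z := by
  unfold IsAxis
  fin_cases a <;> simp [pTab] <;> omega

/-- Multiplication by `pTab a = 2·i^{−a}` preserves the diagonal class. -/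
theorem isDiag_pTab_mul_iff (a : Fin 4) (z : GaussianInt) : IsDiag (pTab a * z) ↔ IsDiag z := by
  unfold IsDiag
  fin_cases a <;> simp [pTab] <;> omega

/-- Multiplication by `4` preserves the axis class. -/
theorem isAxis_four_mul_iff (z : GaussianInt) : IsAxis (4 * z) ↔ IsAxis z := by
  unfold IsAxis
  simp only [Zsqrtd.re_mul, Zsqrtd.im_mul, Zsqrtd.re_ofNat, Zsqrtd.im_ofNat]
  omega

/-- Multiplication by `4` preserves the diagonal class. -/
theorem isDiag_four_mul_iff (z : GaussianInt) : IsDiag (4 * z) ↔ IsDiag z := by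
  unfold IsDiag
  simp only [Zsqrtd.re_mul, Zsqrtd.im_mul, Zsqrtd.re_ofNat, Zsqrtd.im_ofNat]
  omega

/-! ## §2 The Weil moments of the slice-pair designs of a pure design -/

/-- **ADJACENT PAIRS:** for a pure design (n ≥ 1), `4·W(sl m a) = (1 − i)i^{−a}·W(m)`. -/
theorem four_mul_vmoment_sl_plus (hn : 0 < n) (m : Letter (n + 1) → ℤ)
    (hpure : ∀ ε : Eps (n + 1), ε ≠ plus → ε ≠ minus → vmoment m ε = 0) (a : Fin 4) :
    4 * vmoment (sl m a) plus = uTab a * vmoment m plus := by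
  have h4 := four_mul_pair m plus a
  have h0p : (Fin.cons 0 (plus : Eps n) : Eps (n + 1)) ≠ plus := by
    intro hc; have := congrFun hc 0; simp [plus] at this
  have h0m : (Fin.cons 0 (plus : Eps n) : Eps (n + 1)) ≠ minus := by
    intro hc; have := congrFun hc 0; simp [minus] at this
  have h2p : (Fin.cons 2 (plus : Eps n) : Eps (n + 1)) ≠ plus := by
    intro hc; have := congrFun hc 0; simp [plus] at this
  have h2m : (Fin.cons 2 (plus : Eps n) : Eps (n + 1)) ≠ minus := by
    intro hc
    have := congrFun hc (Fin.succ ⟨0, hn⟩)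
    rw [Fin.cons_succ] at this
    simp [plus, minus] at this
  rw [hpure _ h0p h0m, hpure _ h2p h2m, cons_one_plus, mul_zero, mul_zero, zero_add, add_zero] at h4
  rw [vmoment_sl]
  exact h4

/-- **OPPOSITE PAIRS:** for a pure design (n ≥ 1), `4·W(slOpp m a) = 2i^{−a}·W(m)`. -/
theorem four_mul_vmoment_slOpp_plus (hn : 0 < n) (m : Letter (n + 1) → ℤ)
    (hpure : ∀ ε : Eps (n + 1), ε ≠ plus → ε ≠ minus → vmoment m ε = 0) (a : Fin 4) :
    4 * vmoment (slOpp m a) plus = pTab a * vmoment m plus := by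
  have h4 := four_mul_opp m plus a
  have h2p : (Fin.cons 2 (plus : Eps n) : Eps (n + 1)) ≠ plus := by
    intro hc; have := congrFun hc 0; simp [plus] at this
  have h2m : (Fin.cons 2 (plus : Eps n) : Eps (n + 1)) ≠ minus := by
    intro hc
    have := congrFun hc (Fin.succ ⟨0, hn⟩)
    rw [Fin.cons_succ] at this
    simp [plus, minus] at this
  rw [hpure _ h2p h2m, cons_one_plus, mul_zero, add_zero] at h4
  rw [vmoment_slOpp]
  exact h4

/-- The Weil moment of an adjacent slice-pair design is axis iff the Weil moment of the design is diagonal. -/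
theorem isAxis_vmoment_sl_iff (hn : 0 < n) (m : Letter (n + 1) → ℤ)
    (hpure : ∀ ε : Eps (n + 1), ε ≠ plus → ε ≠ minus → vmoment m ε = 0) (a : Fin 4) :
    IsAxis (vmoment (sl m a) plus) ↔ IsDiag (vmoment m plus) := by
  rw [← isAxis_four_mul_iff, four_mul_vmoment_sl_plus hn m hpure a, isAxis_uTab_mul_iff]

/-- The Weil moment of an adjacent slice-pair design is diagonal iff the Weil moment of the design is axis. -/
theorem isDiag_vmoment_sl_iff (hn : 0 < n) (m : Letter (n + 1) → ℤ)
    (hpure : ∀ ε : Eps (n + 1), ε ≠ plus → ε ≠ minus → vmoment m ε = 0) (a : Fin 4) :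
    IsDiag (vmoment (sl m a) plus) ↔ IsAxis (vmoment m plus) := by
  rw [← isDiag_four_mul_iff, four_mul_vmoment_sl_plus hn m hpure a, isDiag_uTab_mul_iff]

/-- The Weil moment of an opposite slice-difference design is axis iff the Weil moment of the design is. -/
theorem isAxis_vmoment_slOpp_iff (hn : 0 < n) (m : Letter (n + 1) → ℤ)
    (hpure : ∀ ε : Eps (n + 1), ε ≠ plus → ε ≠ minus → vmoment m ε = 0) (a : Fin 4) :
    IsAxis (vmoment (slOpp m a) plus) ↔ IsAxis (vmoment m plus) := by
  rw [← isAxis_four_mul_iff, four_mul_vmoment_slOpp_plus hn m hpure a, isAxis_pTab_mul_iff]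

/-- The Weil moment of an opposite slice-difference design is diagonal iff the Weil moment of the design is. -/
theorem isDiag_vmoment_slOpp_iff (hn : 0 < n) (m : Letter (n + 1) → ℤ)
    (hpure : ∀ ε : Eps (n + 1), ε ≠ plus → ε ≠ minus → vmoment m ε = 0) (a : Fin 4) :
    IsDiag (vmoment (slOpp m a) plus) ↔ IsDiag (vmoment m plus) := by
  rw [← isDiag_four_mul_iff, four_mul_vmoment_slOpp_plus hn m hpure a, isDiag_pTab_mul_iff]

/-! ## §3 Counting: THEOREM A and THEOREM B -/

/-- The support of an opposite slice-difference design has at most `#slice_a + #slice_{a+2}` letters. -/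
theorem card_supp_slOpp_le (m : Letter (n + 1) → ℤ) (a : Fin 4) :
    (supp (slOpp m a)).card ≤ (sliceSupp m a).card + (sliceSupp m (a + 2)).card :=
  le_trans (Finset.card_le_card (supp_slOpp_subset m a)) (Finset.card_union_le _ _)

/-- The four adjacent slice-pair designs have at most `2·#supp m` letters in total. -/
theorem sum_card_supp_sl_le (m : Letter (n + 1) → ℤ) :
    (∑ a : Fin 4, (supp (sl m a)).card) ≤ 2 * (supp m).card := by
  calc (∑ a : Fin 4, (supp (sl m a)).card)
      ≤ ∑ a : Fin 4, ((sliceSupp m a).card + (sliceSupp m (a + 1)).card) := Finset.sum_le_sum (fun a _ => card_supp_sl_le m a)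
    _ = (∑ a : Fin 4, (sliceSupp m a).card) + ∑ a : Fin 4, (sliceSupp m (a + 1)).card := Finset.sum_add_distrib
    _ = 2 * (supp m).card := by rw [sum_card_slices_shift, sum_card_slices]; ring

/-- The two opposite slice-difference designs `slOpp m 0`, `slOpp m 1` have at most `#supp m` letters in total. -/
theorem card_supp_slOpp_zero_add_one_le (m : Letter (n + 1) → ℤ) :
    (supp (slOpp m 0)).card + (supp (slOpp m 1)).card ≤ (supp m).card := by
  have h0 := card_supp_slOpp_le m 0
  have h1 := card_supp_slOpp_le m 1
  have hs := sum_card_slices m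
  rw [Fin.sum_univ_four] at hs
  have e0 : ((0 : Fin 4) + 2) = 2 := rfl
  have e1 : ((1 : Fin 4) + 2) = 3 := rfl
  rw [e0] at h0
  rw [e1] at h1
  omega

/-- **THEOREM A (the slice-angle obstruction, every n ≥ 1).** If every pure design on (ℤ∕4)ⁿ with at most `B` letters has an axis
Weil moment (real or purely imaginary), then every pure W-alive design on (ℤ∕4)ⁿ⁺¹ has at least `2(B+1)` letters. -/
theorem two_mul_succ_le_card_supp_of_axis (hn : 0 < n) (B : ℕ)
    (hB : ∀ d : Letter n → ℤ, (∀ ε' : Eps n, ε' ≠ plus → ε' ≠ minus → vmoment d ε' = 0) →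
      (supp d).card ≤ B → IsAxis (vmoment d plus))
    (m : Letter (n + 1) → ℤ) (hpure : ∀ ε : Eps (n + 1), ε ≠ plus → ε ≠ minus → vmoment m ε = 0)
    (halive : vmoment m plus ≠ 0) : 2 * (B + 1) ≤ (supp m).card := by
  by_cases hadj : ∀ a : Fin 4, B + 1 ≤ (supp (sl m a)).card
  · -- all four adjacent pair designs are big
    have hsum : (∑ a : Fin 4, (B + 1)) ≤ ∑ a : Fin 4, (supp (sl m a)).card := Finset.sum_le_sum (fun a _ => hadj a)
    have h2 := sum_card_supp_sl_le m
    simp only [Finset.sum_const, Finset.card_univ, Fintype.card_fin, smul_eq_mul] at hsum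
    omega
  · push Not at hadj
    obtain ⟨a, ha⟩ := hadj
    -- an adjacent pair with ≤ B letters: β is diagonal
    have hdiag : IsDiag (vmoment m plus) :=
      (isAxis_vmoment_sl_iff hn m hpure a).mp (hB _ (sl_pure m hpure a) (by omega))
    by_cases hopp : ∀ a' : Fin 4, B + 1 ≤ (supp (slOpp m a')).card
    · have h0 := hopp 0
      have h1 := hopp 1
      have h2 := card_supp_slOpp_zero_add_one_le m
      omega
    · push Not at hopp
      obtain ⟨a', ha'⟩ := hopp
      -- an opposite pair with ≤ B letters: β is axis, hence β = 0
      have haxis : IsAxis (vmoment m plus) :=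
        (isAxis_vmoment_slOpp_iff hn m hpure a').mp (hB _ (slOpp_pure m hpure a') (by omega))
      exact absurd (eq_zero_of_isAxis_of_isDiag _ haxis hdiag) halive

/-- **THEOREM B (class-specific doubling, every n ≥ 1).** If the pure designs on (ℤ∕4)ⁿ with nonzero diagonal ∕ nonzero axis ∕ neither
axis nor diagonal Weil moment have at least `B₁` ∕ `B₂` ∕ `B₃` letters respectively, then every pure W-alive design on (ℤ∕4)ⁿ⁺¹ has
at least `2·min(max(B₁, B₂), B₃)` letters. -/
theorem two_mul_min_le_card_supp_of_classes (hn : 0 < n) (B₁ B₂ B₃ : ℕ)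
    (h₁ : ∀ d : Letter n → ℤ, (∀ ε' : Eps n, ε' ≠ plus → ε' ≠ minus → vmoment d ε' = 0) →
      IsDiag (vmoment d plus) → vmoment d plus ≠ 0 → B₁ ≤ (supp d).card)
    (h₂ : ∀ d : Letter n → ℤ, (∀ ε' : Eps n, ε' ≠ plus → ε' ≠ minus → vmoment d ε' = 0) →
      IsAxis (vmoment d plus) → vmoment d plus ≠ 0 → B₂ ≤ (supp d).card)
    (h₃ : ∀ d : Letter n → ℤ, (∀ ε' : Eps n, ε' ≠ plus → ε' ≠ minus → vmoment d ε' = 0) →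
      ¬ IsAxis (vmoment d plus) → ¬ IsDiag (vmoment d plus) → B₃ ≤ (supp d).card)
    (m : Letter (n + 1) → ℤ) (hpure : ∀ ε : Eps (n + 1), ε ≠ plus → ε ≠ minus → vmoment m ε = 0)
    (halive : vmoment m plus ≠ 0) : 2 * min (max B₁ B₂) B₃ ≤ (supp m).card := by
  have hsl_ne : ∀ a : Fin 4, vmoment (sl m a) plus ≠ 0 := sl_alive hn m hpure halive
  have hso_ne : ∀ a : Fin 4, vmoment (slOpp m a) plus ≠ 0 := slOpp_alive hn m hpure halive
  have hsum := sum_card_supp_sl_le m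
  have hopp := card_supp_slOpp_zero_add_one_le m
  -- from a uniform bound on the four adjacent pair designs
  have adj_bound : ∀ C : ℕ, (∀ a : Fin 4, C ≤ (supp (sl m a)).card) → 2 * C ≤ (supp m).card := by
    intro C hC
    have hs : (∑ a : Fin 4, C) ≤ ∑ a : Fin 4, (supp (sl m a)).card := Finset.sum_le_sum (fun a _ => hC a)
    simp only [Finset.sum_const, Finset.card_univ, Fintype.card_fin, smul_eq_mul] at hs
    omega
  -- from a uniform bound on the opposite pair designs
  have opp_bound : ∀ C : ℕ, (∀ a : Fin 4, C ≤ (supp (slOpp m a)).card) → 2 * C ≤ (supp m).card := by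
    intro C hC
    have h0 := hC 0
    have h1 := hC 1
    omega
  by_cases hax : IsAxis (vmoment m plus)
  · -- β axis: adjacent pairs diagonal (≥ B₁ each), opposite pairs axis (≥ B₂ each)
    have hA : 2 * B₁ ≤ (supp m).card := adj_bound B₁ (fun a =>
      h₁ _ (sl_pure m hpure a) ((isDiag_vmoment_sl_iff hn m hpure a).mpr hax) (hsl_ne a))
    have hO : 2 * B₂ ≤ (supp m).card := opp_bound B₂ (fun a =>
      h₂ _ (slOpp_pure m hpure a) ((isAxis_vmoment_slOpp_iff hn m hpure a).mpr hax) (hso_ne a))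
    omega
  · by_cases hdg : IsDiag (vmoment m plus)
    · -- β diagonal: adjacent pairs axis (≥ B₂ each), opposite pairs diagonal (≥ B₁ each)
      have hA : 2 * B₂ ≤ (supp m).card := adj_bound B₂ (fun a =>
        h₂ _ (sl_pure m hpure a) ((isAxis_vmoment_sl_iff hn m hpure a).mpr hdg) (hsl_ne a))
      have hO : 2 * B₁ ≤ (supp m).card := opp_bound B₁ (fun a =>
        h₁ _ (slOpp_pure m hpure a) ((isDiag_vmoment_slOpp_iff hn m hpure a).mpr hdg) (hso_ne a))
      omega
    · -- β neither: all pair designs are neither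
      have hA : 2 * B₃ ≤ (supp m).card := adj_bound B₃ (fun a =>
        h₃ _ (sl_pure m hpure a) (fun h => hdg ((isAxis_vmoment_sl_iff hn m hpure a).mp h))
          (fun h => hax ((isDiag_vmoment_sl_iff hn m hpure a).mp h)))
      omega

/-! ## §4 Instances at n = 4 → 5 (conditional on the machine facts, carried as hypotheses) -/

/-- **s(5) ≥ 64 GIVEN AXIS31.** If every pure design on (ℤ∕4)⁴ with at most 31 letters has a real or purely imaginary Weil moment
(the machine fact AXIS31 of `S5-ANGLE-p9g9.md` §2: exact ×2 over the 140 orbit types of the ×2 census ES(4, ≤ 31)), then every pure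
W-alive design on (ℤ∕4)⁵ has at least 64 letters. -/
theorem s5_ge_64_of_axis31
    (axis31 : ∀ d : Letter 4 → ℤ, (∀ ε' : Eps 4, ε' ≠ plus → ε' ≠ minus → vmoment d ε' = 0) →
      (supp d).card ≤ 31 → IsAxis (vmoment d plus))
    (m : Letter 5 → ℤ) (hpure : ∀ ε : Eps 5, ε ≠ plus → ε ≠ minus → vmoment m ε = 0) (halive : vmoment m plus ≠ 0) :
    64 ≤ (supp m).card :=
  two_mul_succ_le_card_supp_of_axis (n := 4) (by norm_num) 31 axis31 m hpure halive

/-- **s(5) ≥ 2·min(max(D, 28), D′) GIVEN the level-4 class minima** s_diag(4) ≥ D, s_axis(4) ≥ 28, s_other(4) ≥ D′ (machine inputs of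
record: D ∈ [32, 39], D′ ≥ 34 — `S5-ANGLE-p9g9.md` §3; with D = 32, D′ = 34 this is again s(5) ≥ 64, with D ≥ 34 it would be 68). -/
theorem s5_ge_of_diag4 (D D' : ℕ)
    (hdiag : ∀ d : Letter 4 → ℤ, (∀ ε' : Eps 4, ε' ≠ plus → ε' ≠ minus → vmoment d ε' = 0) →
      IsDiag (vmoment d plus) → vmoment d plus ≠ 0 → D ≤ (supp d).card)
    (haxis : ∀ d : Letter 4 → ℤ, (∀ ε' : Eps 4, ε' ≠ plus → ε' ≠ minus → vmoment d ε' = 0) →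
      IsAxis (vmoment d plus) → vmoment d plus ≠ 0 → 28 ≤ (supp d).card)
    (hother : ∀ d : Letter 4 → ℤ, (∀ ε' : Eps 4, ε' ≠ plus → ε' ≠ minus → vmoment d ε' = 0) →
      ¬ IsAxis (vmoment d plus) → ¬ IsDiag (vmoment d plus) → D' ≤ (supp d).card)
    (m : Letter 5 → ℤ) (hpure : ∀ ε : Eps 5, ε ≠ plus → ε ≠ minus → vmoment m ε = 0) (halive : vmoment m plus ≠ 0) :
    2 * min (max D 28) D' ≤ (supp m).card :=
  two_mul_min_le_card_supp_of_classes (n := 4) (by norm_num) D 28 D' hdiag haxis hother m hpure halive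

end Summit.Ventures.HSemireg.SignedWeilDesignN
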